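import Mathlib
import Summits.ResolutionOfSingularities.ResolutionOfSingularities.Theorems.WeightedInvariantIota3CalibrationLeibnizCarrier

/-!
# IOTA3-DESIGN calibration row «WHITNEY-CYLINDER»: along the CYLINDER move the Whitney umbrella has NO singular successor —
# the (drop) premise of `CanonicalGameClauseLE` / `CanonicalGameClause` is vacuous (door crux `HypersurfaceCentreConstruction`)

Door crux item stmt-ResolutionOfSingularities-19897 `Theses.WeightedInvariant.HypersurfaceCentreConstruction` (route
`ResolutionOfSingularities/WeightedInvariant`), line `local-engine`, key `stub_localWeightedDropEFT4S`, P3 rung design (IOTA3-DESIGN,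
res-L1-w43-plan-1).  [OURS · L1 W4.3 · res-type-088 (g8) on res-L1-w43-plan-1 DEALS gen 10 #4 (3) / #6 (4) «DOOR-SIDE CALIBRATION ROW
WHITNEY-CYLINDER (P3a beats the atlas loop)»; `--supports 19897 --as helper`, counted 0; definition-free; BC8-type kernel evidence, NOT a
statement of H. Hironaka's manuscript; AI-written (gate-accepted = sorry-free with standard axioms, not refereed).]

THE ROW.  `f = x² + y²·z` (in characteristic `2` the wild Whitney umbrella of the atlas row `whitney_loop`, whose transplant POINT centre
loops); the CYLINDER move `u = (x, y, z)`, `w = (1, 1, 0)` of the door's local game — centre `P = (x, y)`, the singular line, `f ∈ P²`.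
CLAIM: the (drop) conjunct of `CanonicalGameClauseLE d p ι J` (…HypersurfaceLocalGameEFT4SDimLE, l.57–86; = (drop) of `CanonicalGameClause`)
has a VACUOUS premise for this move: at every prime `𝔫` of the game-side carrier `B = cobordantAlgebra' u w = S[t⁻¹, 𝒥ₙ tⁿ]` off the
vertex and every factorisation `f = (t⁻¹)ᵃ · g`, `t⁻¹ ∤ g`, the factor `g` is NOT in `𝔪_𝔫²` — so the inequality `ι(B_𝔫, g) < ι(S, f)` is
asked of NO successor, for EVERY letter `ι` (`whitneyCylinder_dropClause`).

PROOF (generic carrier, `whitneyCylinder_not_mem_maximalIdeal_sq`): `S` a domain with an additive Leibniz map `δ` (`δ x = δ y = 0`,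
`δ z = 1`: a `∂/∂z`) and `x² + y²z ∉ 𝒥₃` (the parameters `x, y` have weight exactly `1`).  (i) `f = (t⁻¹)²·g₀`, `g₀ = x′² + y′²z`
(`x′ = x t`, `y′ = y t`), and `t⁻¹ ∤ g₀` by the coefficientwise criterion of the bridge file (`x² + y²z ∉ 𝒥₃`); unique saturation in the
domain `B` gives `a = 2`, `g = g₀`.  (ii) The coefficientwise extension `D = Σ δ(aₙ)tⁿ` of `δ` is Leibniz on `S[t, t⁻¹]`
(`map_mul_leibniz`) and preserves `B` (`map_mem_cobordantAlgebra'`, since `δ` preserves every `𝒥ₘ`: `leibniz_mem_weightedMonomialIdeal`),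
hence `D(𝔫²) ⊆ 𝔫`.  (iii) `g ∈ 𝔪_𝔫²` gives `s ∉ 𝔫` with `s·g ∈ 𝔫²`; then `g ∈ 𝔫`, `s·Dg = s·y′² ∈ 𝔫`, `y′ ∈ 𝔫`, `x′² = g − y′²z ∈ 𝔫`,
`x′ ∈ 𝔫`, and every vertex generator `b tᵐ` (`b ∈ 𝒥ₘ`, `m ≥ 1`) lies in `(x′, y′) ≤ 𝔫` — contradicting «off the vertex».  No
characteristic hypothesis is used; `t⁻¹ ∈ 𝔫` and `P·B ≤ 𝔫` are not needed (binders `_hT`, `_hP` kept for shape fidelity).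
INSTANCE (`whitneyCylinder_affine_not_mem_maximalIdeal_sq`): `S = k[x, y, z]` (`MvPolynomial (Fin 3) k`, any field `k`), `δ = ∂/∂z`
(`MvPolynomial.pderiv 2`), `x² + y²z ∉ 𝒥₃` by the monomial-ideal criterion; the reading for the local carrier `k[x, y, z]_{(x,y,z)}` is the
restriction to the primes over the origin through the chart → stalk bridge of `…CobordantBlowupExtReesLocalization` (not spelled out).

Part 2 of 2; part 1 `…Iota3CalibrationLeibnizCarrier` supplies the derivation tool (`map_mul_leibniz`, `map_mem_cobordantAlgebra'`,
`leibniz_mem_weightedMonomialIdeal`).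
* §1 `T_mul_T_mul_T_neg_pow`, `whitneyCylinder_not_mem_maximalIdeal_sq`, `whitneyCylinder_dropClause`;
* §2 `X_sq_add_not_mem_weightedMonomialIdeal_three`, `whitneyCylinder_affine_not_mem_maximalIdeal_sq`.

References: J. Włodarczyk, *Functorial resolution by torus actions*, arXiv:2203.03090, Def. 2.3.5 (full cobordant blow-up, vertex)
[Wlodarczyk2022]; the tree files `…HypersurfaceLocalGameEFT` (carrier `cobordantAlgebra'`, `cobordantT'`), `…CentreAssemblyPrimeT`
(`isDomain_cobordantAlgebra'`), `Literature/…/CobordantBlowupExtReesBridge` + `…CobordantBlowupFiltration` (coefficientwise criterion).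
-/

noncomputable section

set_option linter.dupNamespace false -- mandated namespace of this single-conjunct summit

open scoped LaurentPolynomial
open LaurentPolynomial IsLocalRing Literature.AlgebraicGeometry.Resolution

namespace Summit.ResolutionOfSingularities.ResolutionOfSingularities.Cruxes.HypersurfaceCentreConstruction.LocalEngine

namespace Iota3Calibration

variable {S : Type} [CommRing S]

/-! ## §1 The Whitney-umbrella cylinder move has no singular successor off the vertex -/

/-- Laurent bookkeeping: `tⁱ · tʲ · (t⁻¹)^{i+j−m} = tᵐ` for `m ≤ i + j`. -/
theorem T_mul_T_mul_T_neg_pow (i j m : ℕ) (h : m ≤ i + j) :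
    (T (i : ℤ) * T (j : ℤ) * T (-1) ^ (i + j - m) : S[T;T⁻¹]) = T (m : ℤ) := by
  rw [T_pow, ← T_add, ← T_add]
  congr 1
  push_cast [Nat.cast_sub h]
  ring

/-- **WHITNEY-CYLINDER ROW (generic carrier).**  Let `S` be a domain carrying an additive Leibniz map `δ` with `δ x = δ y = 0`,
`δ z = 1` (a `∂/∂z` for the parameters `x, y, z`), and assume `x² + y²z ∉ 𝒥₃((x,y,z),(1,1,0))` (the parameters `x, y` have weight
exactly `1`; automatic for a regular system of parameters).  For the CYLINDER MOVE `u = (x, y, z)`, `w = (1, 1, 0)` (centre `P = (x, y)`,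
`f = x² + y²·z ∈ P²`) of the door's local game: at EVERY prime `𝔫` of the game-side carrier `B = S[t⁻¹, 𝒥ₙ tⁿ]` off the vertex,
and for every factorisation `f = (t⁻¹)ᵃ · g` with `t⁻¹ ∤ g`, the factor `g` is NOT in `𝔪_𝔫²` — so the (drop) premise
`g ∈ 𝔪_𝔫²` of `CanonicalGameClauseLE` / `CanonicalGameClause` is never met and the clause holds vacuously for every `ι`.
Proof: `a = 2`, `g = x′² + y′²z` (`x′ = x t`, `y′ = y t`) by unique `t⁻¹`-saturation in the domain `B`; the coefficientwise
extension `D` of `δ` preserves `B`, satisfies Leibniz, hence `D(𝔫²) ⊆ 𝔫`; if `s·g ∈ 𝔫²` with `s ∉ 𝔫` then `g ∈ 𝔫` and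
`s·D g = s·y′² ∈ 𝔫`, so `y′ ∈ 𝔫`, then `x′² = g − y′² z ∈ 𝔫`, `x′ ∈ 𝔫`, and every vertex generator `a tᵐ` (`a ∈ 𝒥ₘ`, `m ≥ 1`)
lies in `(x′, y′) ≤ 𝔫` — contradicting «off the vertex».  The hypotheses `t⁻¹ ∈ 𝔫` and `P·B ≤ 𝔫` of the clause are not needed
(kept as binders `_hT`, `_hP` for shape fidelity).  [OURS · L1 W4.3 · IOTA3-DESIGN calibration, res-L1-w43-plan-1 DEALS gen 10 #4 (3)] -/
theorem whitneyCylinder_not_mem_maximalIdeal_sq [IsDomain S] (x y z : S) (δ : S →+ S)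
    (hL : ∀ a b : S, δ (a * b) = a * δ b + b * δ a) (hx : δ x = 0) (hy : δ y = 0) (hz : δ z = 1)
    (hI3 : x ^ 2 + y ^ 2 * z ∉ weightedMonomialIdeal ![x, y, z] ![1, 1, 0] 3)
    (𝔫 : Ideal (cobordantAlgebra' ![x, y, z] ![1, 1, 0])) [𝔫.IsPrime]
    (_hT : cobordantT' ![x, y, z] ![1, 1, 0] ∈ 𝔫)
    (_hP : (Ideal.span {x, y}).map (algebraMap S (cobordantAlgebra' ![x, y, z] ![1, 1, 0])) ≤ 𝔫)
    (hV : ¬ extReesAlgebra.vertexIdeal (weightedMonomialIdeal ![x, y, z] ![1, 1, 0]) ≤ 𝔫)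
    (a : ℕ) (g : cobordantAlgebra' ![x, y, z] ![1, 1, 0])
    (hfac : algebraMap S (cobordantAlgebra' ![x, y, z] ![1, 1, 0]) (x ^ 2 + y ^ 2 * z) = cobordantT' ![x, y, z] ![1, 1, 0] ^ a * g)
    (hg : ¬ cobordantT' ![x, y, z] ![1, 1, 0] ∣ g) :
    algebraMap (cobordantAlgebra' ![x, y, z] ![1, 1, 0]) (Localization.AtPrime 𝔫) g ∉
      (maximalIdeal (Localization.AtPrime 𝔫)) ^ 2 := by
  classical
  intro hmem
  have hprime : 𝔫.IsPrime := inferInstance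
  haveI : IsDomain (cobordantAlgebra' ![x, y, z] ![1, 1, 0]) := isDomain_cobordantAlgebra' _ _
  -- the weight-one parameters `x t`, `y t` of `B`
  have hxI : x ∈ weightedMonomialIdeal ![x, y, z] ![1, 1, 0] 1 :=
    Ideal.subset_span ⟨![1, 0, 0], by simp [Fin.sum_univ_three], by simp [Fin.prod_univ_three]⟩
  have hyI : y ∈ weightedMonomialIdeal ![x, y, z] ![1, 1, 0] 1 :=
    Ideal.subset_span ⟨![0, 1, 0], by simp [Fin.sum_univ_three], by simp [Fin.prod_univ_three]⟩
  set x' : cobordantAlgebra' ![x, y, z] ![1, 1, 0] :=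
    ⟨C x * T ((1 : ℕ) : ℤ), extReesAlgebra.C_mul_T_mem _ one_pos hxI⟩ with hx'
  set y' : cobordantAlgebra' ![x, y, z] ![1, 1, 0] :=
    ⟨C y * T ((1 : ℕ) : ℤ), extReesAlgebra.C_mul_T_mem _ one_pos hyI⟩ with hy'
  set Tm := cobordantT' ![x, y, z] ![1, 1, 0] with hTm
  set g₀ : cobordantAlgebra' ![x, y, z] ![1, 1, 0] :=
    x' ^ 2 + y' ^ 2 * algebraMap S (cobordantAlgebra' ![x, y, z] ![1, 1, 0]) z with hg₀
  have hx'c : (x' : S[T;T⁻¹]) = C x * T 1 := rfl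
  have hy'c : (y' : S[T;T⁻¹]) = C y * T 1 := rfl
  have hTmc : (Tm : S[T;T⁻¹]) = T (-1) := rfl
  have hg₀c : (g₀ : S[T;T⁻¹]) = C (x ^ 2 + y ^ 2 * z) * T 2 := by
    rw [hg₀]
    simp only [AddMemClass.coe_add, MulMemClass.coe_mul, SubmonoidClass.coe_pow, Subalgebra.coe_algebraMap,
      ← LaurentPolynomial.C_eq_algebraMap, hx'c, hy'c]
    rw [map_add, map_mul, map_pow, map_pow, mul_pow, mul_pow, T_pow, mul_one]
    ring
  -- (ii) the factorisation `f = (t⁻¹)² · g₀`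
  have hF : algebraMap S (cobordantAlgebra' ![x, y, z] ![1, 1, 0]) (x ^ 2 + y ^ 2 * z) = Tm ^ 2 * g₀ := by
    apply Subtype.ext
    rw [Subalgebra.coe_algebraMap, ← LaurentPolynomial.C_eq_algebraMap, MulMemClass.coe_mul, SubmonoidClass.coe_pow, hTmc, hg₀c,
      T_pow, mul_comm (C _) (T 2), ← mul_assoc, ← T_add]
    norm_num
  -- (iii) `t⁻¹ ∤ g₀` (else `x² + y²z ∈ 𝒥₃`)
  have hTm0 : Tm ≠ 0 := fun h0 => by
    have h1 := congrArg Subtype.val h0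
    rw [hTmc, ZeroMemClass.coe_zero] at h1
    exact (isUnit_T (R := S) (-1 : ℤ)).ne_zero h1
  have hg₀T : ¬ Tm ∣ g₀ := by
    rintro ⟨h, hh⟩
    have hcoe : (h : S[T;T⁻¹]) = C (x ^ 2 + y ^ 2 * z) * T ((3 : ℕ) : ℤ) := by
      have h1 : (g₀ : S[T;T⁻¹]) = T (-1) * (h : S[T;T⁻¹]) := by rw [hh, MulMemClass.coe_mul, hTmc]
      calc (h : S[T;T⁻¹]) = T 1 * (T (-1) * (h : S[T;T⁻¹])) := by rw [← mul_assoc, ← T_add]; norm_num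
        _ = _ := by rw [← h1, hg₀c, mul_comm (T 1), mul_assoc, ← T_add]; norm_num
    have hmemB := h.2
    rw [hcoe, extReesAlgebra_weightedMonomialIdeal_eq_extendedRees, IdealFiltration.C_mul_T_mem_extendedRees_iff,
      ← weightedMonomialIdeal_eq_weightedFiltration_ideal] at hmemB
    exact hI3 hmemB
  -- (iv) uniqueness of the saturation: `a = 2`, `g = g₀`
  rw [hF] at hfac
  have hgg : g = g₀ := by
    rcases Nat.lt_trichotomy a 2 with hlt | heq | hgt
    · exfalso
      apply hg
      obtain ⟨d, hd⟩ := Nat.exists_eq_add_of_lt hlt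
      refine ⟨Tm ^ d * g₀, mul_left_cancel₀ (pow_ne_zero a hTm0) ?_⟩
      rw [← hfac, show Tm ^ a * (Tm * (Tm ^ d * g₀)) = Tm ^ (a + d + 1) * g₀ by ring, ← hd]
    · subst heq
      exact (mul_left_cancel₀ (pow_ne_zero 2 hTm0) hfac).symm
    · exfalso
      apply hg₀T
      obtain ⟨d, rfl⟩ := Nat.exists_eq_add_of_lt hgt
      refine ⟨Tm ^ d * g, mul_left_cancel₀ (pow_ne_zero 2 hTm0) ?_⟩
      rw [hfac]
      ring
  subst hgg
  -- (v) from `g ∈ 𝔪_𝔫²`: an `s ∉ 𝔫` with `s · g ∈ 𝔫²`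
  obtain ⟨s, hs𝔫, hsg⟩ : ∃ s ∉ 𝔫, s * g₀ ∈ 𝔫 ^ 2 := by
    rw [← Localization.AtPrime.map_eq_maximalIdeal, ← Ideal.map_pow,
      IsLocalization.mem_map_algebraMap_iff 𝔫.primeCompl] at hmem
    obtain ⟨⟨⟨c, hc⟩, s⟩, hcs⟩ := hmem
    rw [← map_mul, IsLocalization.eq_iff_exists 𝔫.primeCompl] at hcs
    obtain ⟨c', hc'⟩ := hcs
    refine ⟨c' * s, fun h => (hprime.mem_or_mem h).elim c'.2 s.2, ?_⟩
    have h2 : (c' : cobordantAlgebra' ![x, y, z] ![1, 1, 0]) * s * g₀ = c' * c := by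
      rw [← hc', mul_assoc, mul_comm (s : cobordantAlgebra' ![x, y, z] ![1, 1, 0]) g₀]
    rw [h2]
    exact Ideal.mul_mem_left _ _ hc
  -- (vi) the coefficientwise `∂/∂z` on `B`
  have hI : ∀ (m : ℕ) (b : S), b ∈ weightedMonomialIdeal ![x, y, z] ![1, 1, 0] m →
      δ b ∈ weightedMonomialIdeal ![x, y, z] ![1, 1, 0] m :=
    leibniz_mem_weightedMonomialIdeal _ _ δ hL (fun i hi => by
      fin_cases i
      · exact hx
      · exact hy
      · simp at hi) 
  let D : cobordantAlgebra' ![x, y, z] ![1, 1, 0] → cobordantAlgebra' ![x, y, z] ![1, 1, 0] :=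
    fun b => ⟨AddMonoidAlgebra.map δ b, map_mem_cobordantAlgebra' _ _ δ hI b.2⟩
  have hDval : ∀ b, ((D b : cobordantAlgebra' ![x, y, z] ![1, 1, 0]) : S[T;T⁻¹]) = AddMonoidAlgebra.map δ b := fun b => rfl
  have hDadd : ∀ b c, D (b + c) = D b + D c := fun b c => Subtype.ext (AddMonoidAlgebra.map_add δ _ _)
  have hDmul : ∀ b c, D (b * c) = b * D c + c * D b := fun b c => Subtype.ext (map_mul_leibniz δ hL _ _)
  have hDsq : ∀ v ∈ 𝔫 ^ 2, D v ∈ 𝔫 := by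
    intro v hv
    rw [pow_two] at hv
    refine Submodule.mul_induction_on hv (fun b hb c hc => ?_) (fun v₁ v₂ h₁ h₂ => ?_)
    · rw [hDmul]
      exact Ideal.add_mem _ (Ideal.mul_mem_right _ _ hb) (Ideal.mul_mem_right _ _ hc)
    · rw [hDadd]
      exact Ideal.add_mem _ h₁ h₂
  -- (vii) `D g₀ = y′²`
  have hδf : δ (x ^ 2 + y ^ 2 * z) = y ^ 2 := by
    rw [map_add, pow_two, pow_two, hL, hx, hL, hL, hy, hz]
    ring
  have hDg₀ : D g₀ = y' ^ 2 := by
    apply Subtype.ext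
    rw [hDval, hg₀c, map_C_mul_T, hδf, SubmonoidClass.coe_pow, hy'c, mul_pow, map_pow, T_pow, mul_one]
    norm_num
  -- (viii) the chain of memberships
  have hg₀𝔫 : g₀ ∈ 𝔫 :=
    ((hprime.mem_or_mem (Ideal.pow_le_self two_ne_zero hsg)).resolve_left hs𝔫)
  have h1 : D (s * g₀) ∈ 𝔫 := hDsq _ hsg
  rw [hDmul, hDg₀] at h1
  have h2 : s * y' ^ 2 ∈ 𝔫 := by
    have h3 := Ideal.sub_mem _ h1 (Ideal.mul_mem_right (D s) _ hg₀𝔫)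
    rwa [add_sub_cancel_right] at h3
  have hy'𝔫 : y' ∈ 𝔫 := by
    rcases hprime.mem_or_mem h2 with h | h
    · exact absurd h hs𝔫
    · exact hprime.mem_of_pow_mem 2 h
  have hx'𝔫 : x' ∈ 𝔫 := by
    have h4 : x' ^ 2 = g₀ - y' ^ 2 * algebraMap S (cobordantAlgebra' ![x, y, z] ![1, 1, 0]) z := by rw [hg₀]; ring
    have h5 : x' ^ 2 ∈ 𝔫 := by
      rw [h4]
      exact Ideal.sub_mem _ hg₀𝔫 (Ideal.mul_mem_right _ _ (Ideal.pow_mem_of_mem 𝔫 hy'𝔫 2 two_pos))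
    exact hprime.mem_of_pow_mem 2 h5
  -- (ix) off the vertex is violated: every vertex generator lies in `(x′, y′) ≤ 𝔫`
  apply hV
  rw [extReesAlgebra.vertexIdeal, Ideal.span_le]
  rintro v ⟨m, hm, b, hb, hv⟩
  suffices key : ∀ b : S, b ∈ weightedMonomialIdeal ![x, y, z] ![1, 1, 0] m →
      ∀ hbm : C b * T (m : ℤ) ∈ extReesAlgebra (weightedMonomialIdeal ![x, y, z] ![1, 1, 0]),
        (⟨C b * T (m : ℤ), hbm⟩ : cobordantAlgebra' ![x, y, z] ![1, 1, 0]) ∈ 𝔫 by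
    have hvB : C b * T (m : ℤ) ∈ extReesAlgebra (weightedMonomialIdeal ![x, y, z] ![1, 1, 0]) := hv ▸ v.2
    have hveq : v = ⟨C b * T (m : ℤ), hvB⟩ := Subtype.ext hv
    rw [SetLike.mem_coe, hveq]
    exact key b hb hvB
  intro b hb
  unfold weightedMonomialIdeal at hb
  refine Submodule.span_induction
    (p := fun b _ => ∀ hbm : C b * T (m : ℤ) ∈ extReesAlgebra (weightedMonomialIdeal ![x, y, z] ![1, 1, 0]),
      (⟨C b * T (m : ℤ), hbm⟩ : cobordantAlgebra' ![x, y, z] ![1, 1, 0]) ∈ 𝔫) ?_ ?_ ?_ ?_ hb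
  · rintro _ ⟨α, hα, rfl⟩ hbm
    have hα' : m ≤ α 0 + α 1 := by simpa [Fin.sum_univ_three] using hα
    have he : (⟨C (∏ i, ![x, y, z] i ^ α i) * T (m : ℤ), hbm⟩ : cobordantAlgebra' ![x, y, z] ![1, 1, 0]) =
        x' ^ α 0 * y' ^ α 1 * algebraMap S (cobordantAlgebra' ![x, y, z] ![1, 1, 0]) z ^ α 2 * Tm ^ (α 0 + α 1 - m) := by
      apply Subtype.ext
      simp only [MulMemClass.coe_mul, SubmonoidClass.coe_pow, Subalgebra.coe_algebraMap, ← LaurentPolynomial.C_eq_algebraMap,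
        hx'c, hy'c, hTmc]
      rw [Fin.prod_univ_three]
      simp only [Matrix.cons_val_zero, Matrix.cons_val_one, Matrix.cons_val_two, Matrix.tail_cons, Matrix.head_cons]
      rw [map_mul, map_mul, map_pow, map_pow, map_pow, mul_pow, mul_pow, T_pow, T_pow, mul_one, mul_one,
        ← T_mul_T_mul_T_neg_pow (α 0) (α 1) m hα']
      ring
    rw [he]
    rcases Nat.eq_zero_or_pos (α 0) with h0 | h0
    · have h1 : 0 < α 1 := by omega
      exact Ideal.mul_mem_right _ _ (Ideal.mul_mem_right _ _ (Ideal.mul_mem_left _ _ (Ideal.pow_mem_of_mem 𝔫 hy'𝔫 _ h1)))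
    · exact Ideal.mul_mem_right _ _ (Ideal.mul_mem_right _ _ (Ideal.mul_mem_right _ _ (Ideal.pow_mem_of_mem 𝔫 hx'𝔫 _ h0)))
  · intro hbm
    have h0 : (⟨C (0 : S) * T (m : ℤ), hbm⟩ : cobordantAlgebra' ![x, y, z] ![1, 1, 0]) = 0 := Subtype.ext (by simp)
    rw [h0]
    exact Ideal.zero_mem _
  · intro b₁ b₂ hb₁ hb₂ h₁ h₂ hbm
    have hm₁ := extReesAlgebra.C_mul_T_mem (weightedMonomialIdeal ![x, y, z] ![1, 1, 0]) hm
      (show b₁ ∈ weightedMonomialIdeal ![x, y, z] ![1, 1, 0] m from hb₁)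
    have hm₂ := extReesAlgebra.C_mul_T_mem (weightedMonomialIdeal ![x, y, z] ![1, 1, 0]) hm
      (show b₂ ∈ weightedMonomialIdeal ![x, y, z] ![1, 1, 0] m from hb₂)
    have hsum : (⟨C (b₁ + b₂) * T (m : ℤ), hbm⟩ : cobordantAlgebra' ![x, y, z] ![1, 1, 0]) =
        ⟨C b₁ * T (m : ℤ), hm₁⟩ + ⟨C b₂ * T (m : ℤ), hm₂⟩ := Subtype.ext (by simp [add_mul])
    rw [hsum]
    exact Ideal.add_mem _ (h₁ hm₁) (h₂ hm₂)
  · intro r b hbs h hbm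
    have hmb := extReesAlgebra.C_mul_T_mem (weightedMonomialIdeal ![x, y, z] ![1, 1, 0]) hm
      (show b ∈ weightedMonomialIdeal ![x, y, z] ![1, 1, 0] m from hbs)
    have hsm : (⟨C (r • b) * T (m : ℤ), hbm⟩ : cobordantAlgebra' ![x, y, z] ![1, 1, 0]) =
        algebraMap S (cobordantAlgebra' ![x, y, z] ![1, 1, 0]) r * ⟨C b * T (m : ℤ), hmb⟩ :=
      Subtype.ext (by simp [Subalgebra.coe_algebraMap, ← LaurentPolynomial.C_eq_algebraMap, mul_assoc])
    rw [hsm]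
    exact Ideal.mul_mem_left _ _ (h hmb)

/-- **The (drop) conjunct of `CanonicalGameClauseLE` / `CanonicalGameClause` for the Whitney-cylinder move holds VACUOUSLY, for every
letter `ι`** (generic carrier as in `whitneyCylinder_not_mem_maximalIdeal_sq`). -/
theorem whitneyCylinder_dropClause [IsDomain S] (x y z : S) (δ : S →+ S)
    (hL : ∀ a b : S, δ (a * b) = a * δ b + b * δ a) (hx : δ x = 0) (hy : δ y = 0) (hz : δ z = 1)
    (hI3 : x ^ 2 + y ^ 2 * z ∉ weightedMonomialIdeal ![x, y, z] ![1, 1, 0] 3)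
    (ι : (R : Type) → [CommRing R] → R → Ordinal.{0}) :
    ∀ (𝔫 : Ideal (cobordantAlgebra' ![x, y, z] ![1, 1, 0])) [𝔫.IsPrime],
      cobordantT' ![x, y, z] ![1, 1, 0] ∈ 𝔫 →
      (Ideal.span {x, y}).map (algebraMap S (cobordantAlgebra' ![x, y, z] ![1, 1, 0])) ≤ 𝔫 →
      ¬ (extReesAlgebra.vertexIdeal (weightedMonomialIdeal ![x, y, z] ![1, 1, 0]) ≤ 𝔫) →
      ∀ (a : ℕ) (g : cobordantAlgebra' ![x, y, z] ![1, 1, 0]),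
        algebraMap S (cobordantAlgebra' ![x, y, z] ![1, 1, 0]) (x ^ 2 + y ^ 2 * z) = cobordantT' ![x, y, z] ![1, 1, 0] ^ a * g →
        ¬ (cobordantT' ![x, y, z] ![1, 1, 0] ∣ g) →
        algebraMap (cobordantAlgebra' ![x, y, z] ![1, 1, 0]) (Localization.AtPrime 𝔫) g ∈
          (maximalIdeal (Localization.AtPrime 𝔫)) ^ 2 →
        ι (Localization.AtPrime 𝔫) (algebraMap (cobordantAlgebra' ![x, y, z] ![1, 1, 0]) (Localization.AtPrime 𝔫) g) <
          ι S (x ^ 2 + y ^ 2 * z) :=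
  fun 𝔫 _ hT hP hV a g hfac hg hmem =>
    absurd hmem (whitneyCylinder_not_mem_maximalIdeal_sq x y z δ hL hx hy hz hI3 𝔫 hT hP hV a g hfac hg)

/-! ## §2 The affine model `S = k[x, y, z]` (any field; the atlas row is characteristic `2`) -/

/-- In `k[x, y, z]`: `x² + y²z ∉ 𝒥₃((x,y,z),(1,1,0)) = (x^i y^j z^l : i + j ≥ 3)` (the monomial `x²` has `(x,y)`-degree `2`). -/
theorem X_sq_add_not_mem_weightedMonomialIdeal_three (k : Type) [Field k] :
    (MvPolynomial.X 0 ^ 2 + MvPolynomial.X 1 ^ 2 * MvPolynomial.X 2 : MvPolynomial (Fin 3) k) ∉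
      weightedMonomialIdeal ![MvPolynomial.X 0, MvPolynomial.X 1, MvPolynomial.X 2] ![1, 1, 0] 3 := by
  classical
  intro h
  -- the generators are the monomials `monomial s 1`, `s 0 + s 1 ≥ 3`
  have hle : weightedMonomialIdeal ![MvPolynomial.X 0, MvPolynomial.X 1, MvPolynomial.X 2] ![1, 1, 0] 3 ≤
      Ideal.span ((fun s : Fin 3 →₀ ℕ => MvPolynomial.monomial s (1 : k)) '' {s | 3 ≤ s 0 + s 1}) := by
    unfold weightedMonomialIdeal
    refine Ideal.span_mono ?_
    rintro _ ⟨α, hα, rfl⟩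
    refine ⟨Finsupp.equivFunOnFinite.symm α, by simpa [Fin.sum_univ_three] using hα, ?_⟩
    show MvPolynomial.monomial (Finsupp.equivFunOnFinite.symm α) (1 : k) = _
    rw [MvPolynomial.monomial_eq, MvPolynomial.C_1, one_mul, Finsupp.prod_fintype _ _ (fun i => by rw [pow_zero])]
    simp only [Finsupp.coe_equivFunOnFinite_symm]
    refine Fintype.prod_congr _ _ fun i => ?_
    fin_cases i <;> simp
  have hmem := (MvPolynomial.mem_ideal_span_monomial_image.mp (hle h)) (Finsupp.single 0 2) ?_
  · obtain ⟨si, hsi, hle'⟩ := hmem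
    have h0 : si 0 ≤ 2 := by simpa using hle' 0
    have h1 : si 1 ≤ 0 := by simpa using hle' 1
    have h3 : 3 ≤ si 0 + si 1 := hsi
    omega
  · rw [MvPolynomial.mem_support_iff, MvPolynomial.coeff_add, MvPolynomial.coeff_X_pow,
      if_pos rfl, show (MvPolynomial.X 1 ^ 2 * MvPolynomial.X 2 : MvPolynomial (Fin 3) k) =
        MvPolynomial.monomial (Finsupp.single 1 2 + Finsupp.single 2 1) 1 by
          rw [MvPolynomial.X_pow_eq_monomial, MvPolynomial.X, MvPolynomial.monomial_mul, one_mul],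
      MvPolynomial.coeff_monomial, if_neg]
    · norm_num
    · intro heq
      have := congrArg (fun s => s 0) heq
      simp at this

/-- **WHITNEY-CYLINDER ROW on the affine model.**  In `S = k[x, y, z]` (`k` any field — in characteristic `2` the surface
`x² + y²·z = 0` is the WILD Whitney umbrella of the atlas row `whitney_loop`, whose transplant POINT centre loops), the CYLINDER
move `u = (x, y, z)`, `w = (1, 1, 0)` (centre = the singular line `V(x, y)`) has NO singular successor off the vertex: for every
prime `𝔫` of `S[t⁻¹, 𝒥ₙ tⁿ]` off the vertex and every `t⁻¹`-saturated factorisation `x² + y²z = (t⁻¹)ᵃ · g`, `g ∉ 𝔪_𝔫²`.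
(`δ = ∂/∂z` is `MvPolynomial.pderiv 2`.)  The restriction to the primes over the origin is the row for the local carrier
`k[x, y, z]_{(x,y,z)}` through the chart → stalk bridge of `…CobordantBlowupExtReesLocalization` (not spelled out here). -/
theorem whitneyCylinder_affine_not_mem_maximalIdeal_sq (k : Type) [Field k]
    (𝔫 : Ideal (cobordantAlgebra' ![(MvPolynomial.X 0 : MvPolynomial (Fin 3) k), MvPolynomial.X 1, MvPolynomial.X 2] ![1, 1, 0]))
    [𝔫.IsPrime]
    (_hT : cobordantT' ![(MvPolynomial.X 0 : MvPolynomial (Fin 3) k), MvPolynomial.X 1, MvPolynomial.X 2] ![1, 1, 0] ∈ 𝔫)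
    (_hP : (Ideal.span {(MvPolynomial.X 0 : MvPolynomial (Fin 3) k), MvPolynomial.X 1}).map (algebraMap _ _) ≤ 𝔫)
    (hV : ¬ extReesAlgebra.vertexIdeal
      (weightedMonomialIdeal ![(MvPolynomial.X 0 : MvPolynomial (Fin 3) k), MvPolynomial.X 1, MvPolynomial.X 2] ![1, 1, 0]) ≤ 𝔫)
    (a : ℕ) (g : cobordantAlgebra' ![(MvPolynomial.X 0 : MvPolynomial (Fin 3) k), MvPolynomial.X 1, MvPolynomial.X 2] ![1, 1, 0])
    (hfac : algebraMap (MvPolynomial (Fin 3) k) _ (MvPolynomial.X 0 ^ 2 + MvPolynomial.X 1 ^ 2 * MvPolynomial.X 2) =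
      cobordantT' ![(MvPolynomial.X 0 : MvPolynomial (Fin 3) k), MvPolynomial.X 1, MvPolynomial.X 2] ![1, 1, 0] ^ a * g)
    (hg : ¬ cobordantT' ![(MvPolynomial.X 0 : MvPolynomial (Fin 3) k), MvPolynomial.X 1, MvPolynomial.X 2] ![1, 1, 0] ∣ g) :
    algebraMap _ (Localization.AtPrime 𝔫) g ∉ (maximalIdeal (Localization.AtPrime 𝔫)) ^ 2 := by
  set δ : MvPolynomial (Fin 3) k →+ MvPolynomial (Fin 3) k :=
    (MvPolynomial.pderiv 2 : Derivation k (MvPolynomial (Fin 3) k) (MvPolynomial (Fin 3) k)).toLinearMap.toAddMonoidHom with hδ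
  have hδapp : ∀ q, δ q = MvPolynomial.pderiv 2 q := fun q => rfl
  refine whitneyCylinder_not_mem_maximalIdeal_sq (MvPolynomial.X 0) (MvPolynomial.X 1) (MvPolynomial.X 2) δ
    (fun p q => by rw [hδapp, hδapp, hδapp, Derivation.leibniz, smul_eq_mul, smul_eq_mul]) ?_ ?_ ?_
    (X_sq_add_not_mem_weightedMonomialIdeal_three k) 𝔫 _hT _hP hV a g hfac hg
  · rw [hδapp, MvPolynomial.pderiv_X_of_ne (by decide)]
  · rw [hδapp, MvPolynomial.pderiv_X_of_ne (by decide)]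
  · rw [hδapp, MvPolynomial.pderiv_X_self]

end Iota3Calibration

end Summit.ResolutionOfSingularities.ResolutionOfSingularities.Cruxes.HypersurfaceCentreConstruction.LocalEngine

end
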